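import Summits.MatrixMultiplication.MatrixMultiplication.Theorems.SoloInformedValHubPairFaces
import Summits.MatrixMultiplication.MatrixMultiplication.Theorems.SoloInformedValMixedImagesWitness

/-!
# A superlinear hub pair: the rotated coordinate blocks

Solo-informed MatrixMultiplication, gen 81 (dossier `paper/val-superlinear.md` §15.8 (b′) and (n)(xv); CLAIMS c551, c593).

The two-step local packing statement (U8) — "if a vertex is triangle-adjacent to every vertex of a neighbour class then
`T ≤ |G|`", in particular "`v₁ + v₂ ≤ |G|` for every accidental-free union of two complete blocks with a common hub row and
disjoint `J`- and `K`-classes" (U8*) — is FALSE.  THE ROTATED COORDINATE BLOCKS: in `G = G₁ × G₂ × G₃` take block 1 with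
rows along the first factor, columns along the second and `K`-classes along the third, and block 2 ROTATED (rows along
the second factor, columns along the third, `K`-classes along the first), each factor set being the whole factor minus
one point and the blocks translated generically; the union is accidental-free, the two row classes meet in the hub
`0`, and `T = 2 (|G₁| - 1)(|G₂| - 1)(|G₃| - 1)`, which exceeds `|G|` from `|G| = 125` on and has density `T/|G| → 2`.
This file certifies the smallest CYCLIC instance, `ZMod 140 = ZMod 4 × ZMod 5 × ZMod 7` (by CRT):

  `X₁ = {0, 70, 105}`, `Y₁ = {0, 28, 56, 112}`, `Z₁ = {0, 20, 40, 60, 80, 100}` (volume `72`),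
  `X₂ = {0, 28, 84, 112}`, `Y₂ = {5, 25, 45, 65, 85, 125}`, `Z₂ = {36, 71, 106}` (volume `72`),

an accidental-free hub pair (`rot140_noAccidental`, via the Boolean list test `accFree` / `noAccidental_of_accFree` — a kernel
computation over `36 · 42 · 30` edge triples) with
`T = 144 > 140 = |G|` triangles (`rot140_card_triangleSet`); hence `not_hubPair_packing_zmod140`.  No `sorry`.
-/

namespace Summit.MatrixMultiplication.MatrixMultiplication.Theorems.SoloVal

open Finset

section FiniteCheck

variable {G : Type*} [AddCommGroup G] [DecidableEq G]
variable {I J K : Type*} [DecidableEq I] [DecidableEq J] [DecidableEq K]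

/-- Boolean accidental-freeness test over explicit edge LISTS: every edge triple either has a non-vanishing
alternating sum or is the trivial (matching) triple. -/
def accFree (x : I → G) (y : J → G) (z : K → G) (L₁ : List (I × J)) (L₂ : List (J × K)) (L₃ : List (K × I)) :
    Bool :=
  L₁.all fun e₁ => L₃.all fun e₃ => L₂.all fun e₂ =>
    decide ((x e₁.1 - y e₁.2) + (y e₂.1 - z e₂.2) + (z e₃.1 - x e₃.2) ≠ 0 ∨
      (e₁.1 = e₃.2 ∧ e₁.2 = e₂.1 ∧ e₂.2 = e₃.1))

/-- If the Boolean test passes on lists containing the three pair graphs, the configuration is accidental-free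
(this turns accidental-freeness of an explicit configuration into a kernel computation on lists). -/
theorem noAccidental_of_accFree (x : I → G) (y : J → G) (z : K → G)
    {HIJ : Finset (I × J)} {HJK : Finset (J × K)} {HKI : Finset (K × I)}
    {L₁ : List (I × J)} {L₂ : List (J × K)} {L₃ : List (K × I)}
    (h : accFree x y z L₁ L₂ L₃ = true) (h₁ : ∀ e ∈ HIJ, e ∈ L₁) (h₂ : ∀ e ∈ HJK, e ∈ L₂)
    (h₃ : ∀ e ∈ HKI, e ∈ L₃) : NoAccidental x y z HIJ HJK HKI := by
  rw [noAccidental_iff_forall_mem]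
  intro e₁ he₁ e₂ he₂ e₃ he₃ h0
  simp only [accFree, List.all_eq_true, decide_eq_true_eq] at h
  rcases h e₁ (h₁ e₁ he₁) e₃ (h₃ e₃ he₃) e₂ (h₂ e₂ he₂) with hne | hconj
  · exact absurd h0 hne
  · exact hconj

omit [AddCommGroup G] in
/-- Pairs of a two-block pair graph lie in the corresponding product LISTS (used to feed `noAccidental_of_accFree`
with lists built from the six classes). -/
theorem forall_mem_blockPairs_mem_list {A B A' B' : Finset G} {LA LB LA' LB' : List G}
    (hA : ∀ a ∈ A, a ∈ LA) (hB : ∀ b ∈ B, b ∈ LB) (hA' : ∀ a ∈ A', a ∈ LA') (hB' : ∀ b ∈ B', b ∈ LB') :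
    ∀ e ∈ blockPairs A B A' B', e ∈ LA ×ˢ LB ++ LA' ×ˢ LB' := by
  rintro ⟨a, b⟩ he
  simp only [blockPairs, Finset.mem_union, Finset.mem_product] at he
  rcases he with ⟨ha, hb⟩ | ⟨ha, hb⟩
  · exact List.mem_append.mpr (Or.inl (List.pair_mem_product.mpr ⟨hA a ha, hB b hb⟩))
  · exact List.mem_append.mpr (Or.inr (List.pair_mem_product.mpr ⟨hA' a ha, hB' b hb⟩))

end FiniteCheck

section Rotated140

/-- Rows of block 1 (the first CRT factor `ZMod 4` minus one point, embedded in `ZMod 140`). -/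
def rX₁ : Finset (ZMod 140) := {0, 70, 105}
/-- Columns of block 1 (the factor `ZMod 5` minus one point). -/
def rY₁ : Finset (ZMod 140) := {0, 28, 56, 112}
/-- `K`-classes of block 1 (the factor `ZMod 7` minus one point). -/
def rZ₁ : Finset (ZMod 140) := {0, 20, 40, 60, 80, 100}
/-- Rows of block 2 (ROTATED: along the factor `ZMod 5`; shares the hub row `0` with block 1). -/
def rX₂ : Finset (ZMod 140) := {0, 28, 84, 112}
/-- Columns of block 2 (along the factor `ZMod 7`, translated). -/
def rY₂ : Finset (ZMod 140) := {5, 25, 45, 65, 85, 125}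
/-- `K`-classes of block 2 (along the factor `ZMod 4`, translated). -/
def rZ₂ : Finset (ZMod 140) := {36, 71, 106}

/-- The six classes as explicit lists (for the kernel computation). -/
def lX₁ : List (ZMod 140) := [0, 70, 105]
/-- See `lX₁`. -/
def lY₁ : List (ZMod 140) := [0, 28, 56, 112]
/-- See `lX₁`. -/
def lZ₁ : List (ZMod 140) := [0, 20, 40, 60, 80, 100]
/-- See `lX₁`. -/
def lX₂ : List (ZMod 140) := [0, 28, 84, 112]
/-- See `lX₁`. -/
def lY₂ : List (ZMod 140) := [5, 25, 45, 65, 85, 125]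
/-- See `lX₁`. -/
def lZ₂ : List (ZMod 140) := [36, 71, 106]

/-- The Boolean accidental-freeness test passes on the rotated hub pair (`36 · 30 · 42` edge triples; kernel
computation). -/
theorem rot140_accFree :
    accFree (id : ZMod 140 → ZMod 140) id id (lX₁ ×ˢ lY₁ ++ lX₂ ×ˢ lY₂) (lY₁ ×ˢ lZ₁ ++ lY₂ ×ˢ lZ₂)
      (lZ₁ ×ˢ lX₁ ++ lZ₂ ×ˢ lX₂) = true := by
  decide +kernel

/-- The rotated hub pair is an accidental-free union of two complete blocks (identity potentials). -/
theorem rot140_noAccidental :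
    NoAccidental (id : ZMod 140 → ZMod 140) id id (blockPairs rX₁ rY₁ rX₂ rY₂) (blockPairs rY₁ rZ₁ rY₂ rZ₂)
      (blockPairs rZ₁ rX₁ rZ₂ rX₂) := by
  have hX₁ : ∀ a ∈ rX₁, a ∈ lX₁ := by decide +kernel
  have hY₁ : ∀ a ∈ rY₁, a ∈ lY₁ := by decide +kernel
  have hZ₁ : ∀ a ∈ rZ₁, a ∈ lZ₁ := by decide +kernel
  have hX₂ : ∀ a ∈ rX₂, a ∈ lX₂ := by decide +kernel
  have hY₂ : ∀ a ∈ rY₂, a ∈ lY₂ := by decide +kernel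
  have hZ₂ : ∀ a ∈ rZ₂, a ∈ lZ₂ := by decide +kernel
  exact noAccidental_of_accFree id id id rot140_accFree (forall_mem_blockPairs_mem_list hX₁ hY₁ hX₂ hY₂)
    (forall_mem_blockPairs_mem_list hY₁ hZ₁ hY₂ hZ₂) (forall_mem_blockPairs_mem_list hZ₁ hX₁ hZ₂ hX₂)

/-- It is a hub pair: common row `0`, disjoint column classes, disjoint `K`-classes. -/
theorem rot140_hub : (0 : ZMod 140) ∈ rX₁ ∧ (0 : ZMod 140) ∈ rX₂ ∧ Disjoint rY₁ rY₂ ∧ Disjoint rZ₁ rZ₂ := by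
  decide

/-- Its total volume is `72 + 72 = 144`. -/
theorem rot140_volume :
    rX₁.card * rY₁.card * rZ₁.card + rX₂.card * rY₂.card * rZ₂.card = 144 := by
  decide

/-- Hence it carries `144` triangles — more than the `140` elements of the group. -/
theorem rot140_card_triangleSet :
    (triangleSet (blockPairs rX₁ rY₁ rX₂ rY₂) (blockPairs rY₁ rZ₁ rY₂ rZ₂) (blockPairs rZ₁ rX₁ rZ₂ rX₂)).card = 144 ∧
      Fintype.card (ZMod 140) = 140 := by
  refine ⟨?_, ZMod.card 140⟩
  rw [card_triangleSet_blockPairs_of_disjoint rot140_hub.2.2.1 rot140_hub.2.2.2]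
  exact rot140_volume

/-- REFUTATION OF (U8*): the packing bound `v₁ + v₂ ≤ |G|` fails for accidental-free hub pairs (already in the cyclic
group of order `140`). -/
theorem not_hubPair_packing_zmod140 :
    ¬ ∀ (X₁ Y₁ Z₁ X₂ Y₂ Z₂ : Finset (ZMod 140)) (h : ZMod 140), h ∈ X₁ → h ∈ X₂ → Disjoint Y₁ Y₂ → Disjoint Z₁ Z₂ →
      NoAccidental (id : ZMod 140 → ZMod 140) id id (blockPairs X₁ Y₁ X₂ Y₂) (blockPairs Y₁ Z₁ Y₂ Z₂)
        (blockPairs Z₁ X₁ Z₂ X₂) →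
      X₁.card * Y₁.card * Z₁.card + X₂.card * Y₂.card * Z₂.card ≤ Fintype.card (ZMod 140) := by
  intro h
  have h144 := h rX₁ rY₁ rZ₁ rX₂ rY₂ rZ₂ 0 rot140_hub.1 rot140_hub.2.1 rot140_hub.2.2.1 rot140_hub.2.2.2
    rot140_noAccidental
  rw [rot140_volume, ZMod.card] at h144
  omega

/-- Equivalently, in triangle language: an accidental-free tripartite configuration in which one row vertex is
triangle-adjacent to EVERY column vertex can have more triangles than `|G|` ((U8) fails at the hub). -/
theorem not_twoStep_packing_zmod140 :
    ¬ ∀ (X₁ Y₁ Z₁ X₂ Y₂ Z₂ : Finset (ZMod 140)) (h : ZMod 140), h ∈ X₁ → h ∈ X₂ → Disjoint Y₁ Y₂ → Disjoint Z₁ Z₂ →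
      NoAccidental (id : ZMod 140 → ZMod 140) id id (blockPairs X₁ Y₁ X₂ Y₂) (blockPairs Y₁ Z₁ Y₂ Z₂)
        (blockPairs Z₁ X₁ Z₂ X₂) →
      (triangleSet (blockPairs X₁ Y₁ X₂ Y₂) (blockPairs Y₁ Z₁ Y₂ Z₂) (blockPairs Z₁ X₁ Z₂ X₂)).card ≤
        Fintype.card (ZMod 140) := by
  intro h
  have h144 := h rX₁ rY₁ rZ₁ rX₂ rY₂ rZ₂ 0 rot140_hub.1 rot140_hub.2.1 rot140_hub.2.2.1 rot140_hub.2.2.2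
    rot140_noAccidental
  rw [rot140_card_triangleSet.1, rot140_card_triangleSet.2] at h144
  omega

end Rotated140

end Summit.MatrixMultiplication.MatrixMultiplication.Theorems.SoloVal
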